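import Literature.MathematicalPhysics.QuantumFieldTheory.Balaban1983to89.T3ThresholdRemoval
import Literature.MathematicalPhysics.QuantumFieldTheory.Balaban1983to89.T3ContinuumLaw

/-!
# `Balaban1983to89.T3NestedUnitLaws` — rung R3, the E3 node's VENUE on the three-torus: the unit laws of two consecutive
# approximations are push-forwards of TWO LAWS ON ONE LATTICE under ONE map (`NestedFactorisation` INHABITED for d = 3),
# and the d = 3 versions of the cone's law-level apex binders, BY NAME

Cell `ym3-torus` (HUMAN RULING D-0037, YM ladder rung R3), seat `ym3-torus-p2` gen 2 (the E3-node holder of the cell's typed DAG,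
HOME/TARGET.md v3 §4).  WHAT THIS IS NOT: not d = 4, not infinite volume, not a mass gap (`CrossoverControl` stays open), not Clay,
and NOT the expectations step (E3) itself — every estimate below is a HYPOTHESIS SHAPE of the tree (`T4VarianceMatching`), never
asserted; what is PROVED is the bookkeeping that puts those shapes on the d = 3 scheme's OWN objects.

THE POINT.  `T3ThresholdRemoval` §2 inhabited the cone's interface `T4VarianceMatching.UnitFactorisation` for the d = 3 Wilson
scheme `F.scheme ℰ γ`: every joint expectation of unit-scale averaged loop variables at step `K` is an integral against ONE
probability law `μ_K = unitLaw K` on ONE compact space, the configurations of the unit torus ([Balaban1985UV3] (2) p. 256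
`ρ_{k+1} = Tρ_k`, iterated to the unit lattice, as a LAW).  The open content of R3 on `SU(N)` is exactly `HasContinuumLimit`
(`T3CovarianceRP.continuumYM3Torus_iff_hasContinuumLimit_SU`), i.e. that `K ↦ ∫ Φ dμ_K` converges for the countably many
string observables `Φ`.  This file adds the SECOND interface of the cone's second-moment route, `NestedFactorisation`
(`A_{K+1} = A_K ∘ B_K`: run `K+1`'s `K+1` averagings are its FIRST one followed by run `K`'s `K` averagings — the level
homogeneity of [Balaban1987RG1] (0.4)/(0.11)), INHABITED for d = 3 with `B_K = descend K` := one (0.4) step on the finest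
lattice of `F.P (K+1)` followed by the level identification of `T3LevelShift` (the once-averaged lattice of the `(K+1)`-th
approximation IS the finest lattice of the `K`-th: same torus, same spacing `L·ε_{K+1} = ε_K`).  CONSEQUENCE (tree, by name,
`NestedFactorisation.effLaw_succ_eq_map_descLaw`): `μ_{K+1} = (A_K)_* descLaw_K` and `μ_K = (A_K)_* Gibbs_K` — THE TWO
CONSECUTIVE UNIT LAWS DIFFER ONLY IN THE PAIR (`Gibbs_K`, `descLaw_K`) ON ONE LATTICE: the Wilson measure at spacing `ε_K`,
coupling `β_K = (γε_K)⁻¹`, versus ONE renormalization step ([Balaban1985UV3] (2), [Balaban1985Averaging] (10)) of the Wilson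
measure at spacing `ε_K/L`, coupling `β_{K+1} = L·β_K` (`scheme_β_succ`), read through the `K`-fold averaging `A_K`.
So the d = 3 expectations step, AS A STATEMENT ABOUT BAŁABAN'S OBJECTS, is: a summable comparison of `Gibbs_K` with
`descLaw_K` in any of the cone's currencies — and the d = 3 instances of the cone's apex theorems are then ONE LINE EACH:
`ContinuumYM3Torus F ℰ γ` (all four conjuncts, `SU(N)`, every measurable `ℰ`, every `γ ≥ 0`) ⇐ a summable
DENSITY-LEVEL rate `EffDensityRate` (`μ_{K+1} = g_K·μ_K`, `|g_K − 1| ≤ s_K` on a good set, single-run bad-set weights `w_K`,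
`w'_K` — the K1 sandwich ⊕ K2 large-field shape of the cell's IR node in the law currency; King's (3.9)/(3.10) p. 656 is of this
pointwise kind in the abelian model) ⇐ … ; ⇐ a summable TRANSPORT rate between `μ_K` and `μ_{K+1}` (`EffTransportRate`);
⇐ a summable `L²` / common-noise rate (`EffSecondMomentRate`, `CommonNoiseRate`); ⇐ a summable transport or `L²` rate AT THE
FINEST COMMON LATTICE between `Gibbs_K` and `descLaw_K` (`FineTransportRate`, `FineSecondMomentRate`).

## Contents

§1 `descend F ℰ K : GaugeField (F.P (K+1)) 0 G → GaugeField (F.P K) 0 G` (one (0.4) step + `fieldShift`), `iter_descend`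
   (the `k`-fold averaging of the descended field is the `(k+1)`-fold averaging of the original, read one level up),
   `unitShift_iter_descend` (= `nest`), `measurable_descend`; `scheme_β_succ` (`β_{K+1} = L·β_K`).
§2 `T3Family.nestedFactorisation F ℰ hE γ : NestedFactorisation (F.scheme ℰ γ) (GaugeField (F.P 0) 0 G)`; the descended law
   `T3Family.descLaw` and `integral_descLaw`; `unitLaw_succ_eq_map_descLaw`; `expectAt_succ_eq_integral_descLaw`
   (`⟨∏ W̄⟩_{K+1} = ∫ ∏_C W_C(A_K V) d(descLaw_K)(V)` next to `⟨∏ W̄⟩_K = ∫ ∏_C W_C(A_K U) dGibbs_K(U)`).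
§3 THE d = 3 APEX BINDERS BY NAME (`SU(N)`, measurable `ℰ`, `γ ≥ 0`): `continuumYM3Torus_of_effDensityRate`,
   `…_of_effTransportRate`, `…_of_effSecondMomentRate`, `…_of_commonNoiseRate`, `…_of_fineTransportRate`,
   `…_of_fineSecondMomentRate`; and the law form `existsUnique_osLaw_of_effDensityRate` (one OS-positive, `T₁`-covariant
   continuum law on the loop cube, `T3ContinuumLaw`).
§4 (v2) PRODUCER FORM in the density currency: `effDensityRate_of_densitySandwich` (any `UnitFactorisation`: positive
   densities w.r.t. a reference measure + two-run sandwich on good sets + bad-set masses ⇒ `EffDensityRate`) and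
   `continuumYM3Torus_of_densitySandwich` (the d = 3 statement the expectations step must supply).
§5 (v3) `effDensityRate_of_densitySandwichModConst`: the same with an UNKNOWN constant `c_K` in the sandwich (normalisation
   removes it — no matching of partition functions / vacuum-energy constants is needed in this currency); (v4) its d = 3
   corollary `continuumYM3Torus_of_densitySandwichModConst`.

NOT PROVED, NOT CLAIMED: any rate for any scheme (the located, unprinted content: CMP 102 bounds densities, never expectations —
[Balaban1985UV3] (41) p. 266 / (47) p. 267 give the two-sided small-field sandwich on `ρ_k` whose law reading is the good-set
part of `EffDensityRate`; the large-field weights are the cell's node N5); anything at infinite volume; a mass gap.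
-/

noncomputable section

open MeasureTheory Filter Topology
open Literature.MathematicalPhysics.QuantumFieldTheory.Balaban1983to89.T3ContinuumYM3Torus
open Literature.MathematicalPhysics.QuantumFieldTheory.Balaban1983to89.T3LevelShift
open Literature.MathematicalPhysics.QuantumFieldTheory.Balaban1983to89.T3ThresholdRemoval
open Literature.MathematicalPhysics.QuantumFieldTheory.Balaban1983to89.Missing
open Literature.MathematicalPhysics.QuantumFieldTheory.Balaban1983to89.T4Continuum

namespace Literature.MathematicalPhysics.QuantumFieldTheory.Balaban1983to89.T3NestedUnitLaws

/-- Products of a list of measurable real functions are measurable (local helper). [folklore] -/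
private theorem measurable_list_prod {X : Type*} [MeasurableSpace X] {ι : Type*} (f : ι → X → ℝ)
    (hf : ∀ i, Measurable (f i)) : ∀ l : List ι, Measurable fun x => (l.map fun i => f i x).prod
  | [] => by simp
  | i :: l => by
    show Measurable fun x => f i x * (l.map fun i => f i x).prod
    exact (hf i).mul (measurable_list_prod f hf l)

/-! ## §1 Run `K+1`'s first renormalization step read on run `K`'s finest lattice -/

section Descend

variable (F : T3Family) {G : Type*} [GaugeGroup G] (ℰ : LoopAverage G)

/-- Equal moduli: level `k` of the `K`-th approximation and level `k + 1` of the `(K+1)`-th (both `2·L^{m+K−k}` sites per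
direction — the once-averaged lattice of `T_{ε/L}` is `T_ε`). [cite: Balaban1985UV3, (1)-(3) p.256] -/
theorem sitesPerDir_descend (K k : ℕ) : (F.PP F.m K).sitesPerDir k = (F.PP F.m (K + 1)).sitesPerDir (k + 1) :=
  F.sitesPerDir_eq (by omega)

/-- The bare inverse couplings of consecutive approximations: `β_{K+1} = L·β_K` (`β_K = (γε_K)⁻¹`, `ε_{K+1} = ε_K/L`;
[Balaban1985UV3] (1) p. 256: `g₀² = g²ε`). [cite: Balaban1985UV3, (1)-(3) p.256] -/
theorem scheme_β_succ (γ : ℝ) (K : ℕ) : (F.scheme ℰ γ).β (K + 1) = F.L * (F.scheme ℰ γ).β K := by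
  show (γ * (((F.L : ℝ)⁻¹) ^ (K + 1)))⁻¹ = F.L * (γ * (((F.L : ℝ)⁻¹) ^ K))⁻¹
  rw [pow_succ, ← mul_assoc, mul_inv, inv_inv, mul_comm]

/-- **RUN `K+1`'S FIRST STEP ON RUN `K`'S FINEST LATTICE**: one (0.4) block averaging of a configuration of the finest lattice
`T_{ε_{K+1}}` of the `(K+1)`-th approximation, read — through the level identification of `T3LevelShift` — as a configuration of
the finest lattice `T_{ε_K}` of the `K`-th approximation (`L·ε_{K+1} = ε_K`): the `B_K` of a `T4VarianceMatching.NestedFactorisation`.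
[cite: Balaban1987RG1, (0.4) p.253] -/
def descend (K : ℕ) (U : GaugeField (F.P (K + 1)) 0 G) : GaugeField (F.P K) 0 G :=
  fieldShift (sitesPerDir_descend F K 0) ((BlockAveraging.blockAvg (P := F.P (K + 1)) (j := 0) ℰ).avg U)

/-- **LEVEL HOMOGENEITY OF (0.4)**: `k` averagings of the descended configuration in the `K`-th tower are `k + 1` averagings of
the original configuration in the `(K+1)`-th tower, read one level up ([Balaban1987RG1] (0.11): `Ū^{k} = M^{k}(U)` is given by
one formula at every level; tree `T3LevelShift.blockAvg_fieldShift`). [cite: Balaban1987RG1, (0.11) p.253] -/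
theorem iter_descend (K : ℕ) : ∀ (k : ℕ) (U : GaugeField (F.PP F.m (K + 1)) 0 G),
    Averaging.iter (fun i => BlockAveraging.blockAvg (P := F.PP F.m K) (j := i) ℰ) k (descend F ℰ K U) =
      fieldShift (sitesPerDir_descend F K k)
        (Averaging.iter (fun i => BlockAveraging.blockAvg (P := F.PP F.m (K + 1)) (j := i) ℰ) (k + 1) U)
  | 0, _ => rfl
  | k + 1, U => by
    show (BlockAveraging.blockAvg ℰ).avg
        (Averaging.iter (fun i => BlockAveraging.blockAvg (P := F.PP F.m K) (j := i) ℰ) k (descend F ℰ K U)) =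
      fieldShift _ ((BlockAveraging.blockAvg ℰ).avg
        (Averaging.iter (fun i => BlockAveraging.blockAvg (P := F.PP F.m (K + 1)) (j := i) ℰ) (k + 1) U))
    rw [iter_descend K k U]
    exact blockAvg_fieldShift ℰ _ _ _

/-- **`nest`: `A_{K+1} = A_K ∘ B_K`** — the unit field of the `(K+1)`-th approximation (`K + 1` averagings, then `unitShift`) is
the unit field of the `K`-th approximation evaluated on the descended configuration. [cite: Balaban1987RG1, (0.11) p.253] -/
theorem unitShift_iter_descend (K : ℕ) (U : GaugeField (F.P (K + 1)) 0 G) :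
    unitShift F K (Averaging.iter (fun i => BlockAveraging.blockAvg (P := F.P K) (j := i) ℰ) K (descend F ℰ K U)) =
      unitShift F (K + 1) (Averaging.iter (fun i => BlockAveraging.blockAvg (P := F.P (K + 1)) (j := i) ℰ) (K + 1) U) := by
  show fieldShift (F.sitesPerDir_unit K)
      (Averaging.iter (fun i => BlockAveraging.blockAvg (P := F.PP F.m K) (j := i) ℰ) K (descend F ℰ K U)) =
    fieldShift (F.sitesPerDir_unit (K + 1))
      (Averaging.iter (fun i => BlockAveraging.blockAvg (P := F.PP F.m (K + 1)) (j := i) ℰ) (K + 1) U)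
  rw [iter_descend, fieldShift_fieldShift]

/-- **THE NEXT APPROXIMATION'S OBSERVABLES ON THIS APPROXIMATION'S LATTICE**: the averaged loop variable of label `C` at step
`K + 1` is the step-`K` averaged loop variable of the descended configuration (`nest` read on observables).
[cite: Balaban1987RG1, (0.2)/(0.4) p.252] -/
theorem avgObs_succ_eq_avgObs_descend (K : ℕ) (C : ULoop3 F) (U : GaugeField (F.P (K + 1)) 0 G) :
    F.avgObs ℰ (K + 1) C U = F.avgObs ℰ K C (descend F ℰ K U) := by
  rw [F.avgObs_eq_loopAt_unitShift ℰ (K + 1) C U, F.avgObs_eq_loopAt_unitShift ℰ K C, unitShift_iter_descend]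

variable [MeasurableSpace G] [RegularGaugeGroup G]

/-- `descend` is measurable for a measurable small-loop average. [cite: Balaban1985Averaging, (10) p.19] -/
theorem measurable_descend (hE : ℰ.MeasurableE) (K : ℕ) :
    Measurable (descend F ℰ K : GaugeField (F.P (K + 1)) 0 G → GaugeField (F.P K) 0 G) :=
  (measurable_fieldShift _).comp (F.avgMeasurable_of_measurableE ℰ hE (K + 1) 0)

end Descend

/-! ## §2 `NestedFactorisation` inhabited for d = 3; the descended law; the two consecutive unit laws on one lattice -/

section Nested

variable (F : T3Family) {G : Type*} [GaugeGroup G] [MeasurableSpace G] [HaarData G] [RegularGaugeGroup G]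
  (ℰ : LoopAverage G) (hE : ℰ.MeasurableE) (γ : ℝ)

/-- **THE NESTED FACTORISATION OF THE d = 3 WILSON SCHEME** (the interface `T4VarianceMatching.NestedFactorisation` INHABITED):
the unit factorisation of `T3ThresholdRemoval` (`A_K = unitShift K ∘ avg^K`, `W_C(u) = loopAt u (C.atLevel 0)`) extended by
`B_K = descend K` with `A_{K+1} = A_K ∘ B_K` (`unitShift_iter_descend`). [cite: Balaban1987RG1, (0.4)/(0.11) p.253] -/
def _root_.Literature.MathematicalPhysics.QuantumFieldTheory.Balaban1983to89.T3ContinuumYM3Torus.T3Family.nestedFactorisation :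
    T4VarianceMatching.NestedFactorisation (F.scheme ℰ γ) (GaugeField (F.P 0) 0 G) where
  toUnitFactorisation := F.unitFactorisation ℰ hE γ
  B K := descend F ℰ K
  measurable_B K := measurable_descend F ℰ hE K
  nest K U := (unitShift_iter_descend F ℰ K U).symm

omit [HaarData G] in
/-- The nested factorisation extends the unit factorisation of `T3ThresholdRemoval` (definitional).
[cite: Balaban1987RG1, (0.4)/(0.11) p.253] -/
theorem nestedFactorisation_toUnitFactorisation :
    (F.nestedFactorisation ℰ hE γ).toUnitFactorisation = F.unitFactorisation ℰ hE γ :=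
  rfl

/-- **THE DESCENDED LAW** of step `K`: the push-forward of the `(K+1)`-th Gibbs measure (Wilson measure at spacing `ε_K/L`,
coupling `β_{K+1} = L·β_K`) under `descend K` — ONE complete renormalization step `ρ₁ = Tρ₀` of [Balaban1985UV3] (2) p. 256 /
[Balaban1985Averaging] (10) p. 19, as a LAW on the configurations of `T_{ε_K}`. [cite: Balaban1985UV3, (1)-(3) p.256] -/
def _root_.Literature.MathematicalPhysics.QuantumFieldTheory.Balaban1983to89.T3ContinuumYM3Torus.T3Family.descLaw (K : ℕ) :
    Measure (GaugeField (F.P K) 0 G) :=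
  (F.nestedFactorisation ℰ hE γ).descLaw K

variable {F ℰ γ}

/-- The descended law, unfolded: `descLaw K = (descend K)_* Gibbs_{K+1}`. [cite: Balaban1985UV3, (1)-(3) p.256] -/
theorem descLaw_eq (K : ℕ) :
    F.descLaw ℰ hE γ K =
      Measure.map (descend F ℰ K) (T4GenFunBounds.gibbsMeasure (F.P (K + 1)) ((F.scheme ℰ γ).β (K + 1))) :=
  rfl

/-- The descended laws are probability measures (`γ ≥ 0`). [cite: Balaban1985UV3, (1)-(3) p.256] -/
theorem isProbabilityMeasure_descLaw (hγ : 0 ≤ γ) (K : ℕ) : IsProbabilityMeasure (F.descLaw ℰ hE γ K) :=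
  (F.nestedFactorisation ℰ hE γ).isProbabilityMeasure_descLaw (F.scheme_β_nonneg ℰ hγ) K

/-- Integration against the descended law = integration of `f ∘ descend K` against the `(K+1)`-th Gibbs measure.
[cite: Balaban1985Averaging, (10) p.19] -/
theorem integral_descLaw (K : ℕ) {f : GaugeField (F.P K) 0 G → ℝ} (hf : Measurable f) :
    ∫ V, f V ∂F.descLaw ℰ hE γ K =
      ∫ U, f (descend F ℰ K U) ∂T4GenFunBounds.gibbsMeasure (F.P (K + 1)) ((F.scheme ℰ γ).β (K + 1)) := by
  rw [descLaw_eq, integral_map (measurable_descend F ℰ hE K).aemeasurable hf.aestronglyMeasurable]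

/-- **THE TWO CONSECUTIVE UNIT LAWS ARE PUSH-FORWARDS OF TWO LAWS ON ONE LATTICE UNDER ONE MAP**:
`unitLaw (K+1) = (A_K)_* (descLaw K)` next to `unitLaw K = (A_K)_* Gibbs_K` (the definition) — the unit laws of the `K`-th and
`(K+1)`-th approximations differ only in the pair (Wilson measure at `ε_K`, one renormalization step of the Wilson measure at
`ε_K/L`) on `T_{ε_K}`, read through the `K`-fold averaging (tree `NestedFactorisation.effLaw_succ_eq_map_descLaw`).
[cite: Balaban1985UV3, (1)-(3) p.256] -/
theorem unitLaw_succ_eq_map_descLaw (K : ℕ) :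
    F.unitLaw ℰ hE γ (K + 1) =
      Measure.map (fun U : GaugeField (F.P K) 0 G =>
          unitShift F K (Averaging.iter (fun j => BlockAveraging.blockAvg (P := F.P K) (j := j) ℰ) K U))
        (F.descLaw ℰ hE γ K) :=
  (F.nestedFactorisation ℰ hE γ).effLaw_succ_eq_map_descLaw K

/-- **THE NEXT APPROXIMATION'S EXPECTATIONS ON THIS APPROXIMATION'S LATTICE**:
`⟨∏_{C∈Cs} W̄_C⟩_{K+1} = ∫ ∏_C W_C(A_K V) d(descLaw K)(V)`, to be read next to
`⟨∏_{C∈Cs} W̄_C⟩_K = ∫ ∏_C W_C(A_K U) dGibbs_K(U)` (`T4GenFunBounds.expectAt_eq_integral_gibbs` with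
`T3Family.avgObs_eq_loopAt_unitShift`): the increment of every joint expectation is the difference of the integrals of ONE
function against TWO laws on ONE lattice. [cite: Balaban1985UV3, (1)-(3) p.256] -/
theorem expectAt_succ_eq_integral_descLaw (hγ : 0 ≤ γ) (K : ℕ) (Cs : List (ULoop3 F)) :
    (F.scheme ℰ γ).expectAt (K + 1) Cs = ∫ V, (Cs.map fun C => F.avgObs ℰ K C V).prod ∂F.descLaw ℰ hE γ K := by
  rw [integral_descLaw hE K (measurable_list_prod (fun (C : ULoop3 F) (V : GaugeField (F.P K) 0 G) => F.avgObs ℰ K C V)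
      (fun C => F.measurable_avgObs (F.avgMeasurable_of_measurableE ℰ hE) K C) Cs),
    T4GenFunBounds.expectAt_eq_integral_gibbs _ (F.scheme_β_nonneg ℰ hγ) (K + 1) Cs]
  refine integral_congr_ae (Eventually.of_forall fun U => ?_)
  show (Cs.map fun C => F.avgObs ℰ (K + 1) C U).prod = (Cs.map fun C => F.avgObs ℰ K C (descend F ℰ K U)).prod
  simp_rw [avgObs_succ_eq_avgObs_descend]

/-- … and the same-lattice form of this approximation's expectations (for the record, by name). [cite: Balaban1985UV3, (1)-(3) p.256] -/
theorem expectAt_eq_integral_gibbs (hγ : 0 ≤ γ) (K : ℕ) (Cs : List (ULoop3 F)) :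
    (F.scheme ℰ γ).expectAt K Cs =
      ∫ U, (Cs.map fun C => F.avgObs ℰ K C U).prod ∂T4GenFunBounds.gibbsMeasure (F.P K) ((F.scheme ℰ γ).β K) :=
  T4GenFunBounds.expectAt_eq_integral_gibbs _ (F.scheme_β_nonneg ℰ hγ) K Cs

end Nested

/-! ## §3 The d = 3 apex binders by name: `ContinuumYM3Torus` from a summable law-level comparison, in every currency -/

section Apex

variable {N : ℕ} [NeZero N] (F : T3Family) (ℰ : LoopAverage (Matrix.specialUnitaryGroup (Fin N) ℂ))
  (hE : ℰ.MeasurableE) {γ : ℝ} (hγ : 0 ≤ γ)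

include hγ

/-- **R3 ON ONE THREE-TORUS ⇐ A SUMMABLE DENSITY-LEVEL COMPARISON OF CONSECUTIVE UNIT LAWS** (`SU(N)`, every measurable `ℰ`,
every `γ ≥ 0`): if for every `K` the unit law of the `(K+1)`-th approximation has a density `g_K` with respect to that of the
`K`-th, with `|g_K − 1| ≤ s_K` on a measurable good set and single-run bad-set weights `μ_K(bad) ≤ w_K`,
`μ_{K+1}(bad) ≤ w'_K`, and `Σ s_K, Σ w_K, Σ w'_K < ∞`, then `ContinuumYM3Torus F ℰ γ` — existence AND uniqueness of the
`ε → 0` limit of all joint expectations of unit-scale averaged loop variables, reflection positivity and torus covariance of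
the limit.  The K1-sandwich ⊕ K2-large-field shape of the cell's IR node in the LAW currency (CMP 102's (41)/(47) sandwich
`ρ_k` pointwise between `e^{∓R_k}` times one explicit Gibbs factor on the small-field domain; King's abelian (3.9)/(3.10) p. 656
compare densities of two runs pointwise); tree `UnitFactorisation.hasContinuumLimit_of_effDensityRate` + N1–N3.
[cite: Balaban1985UV3, (41) p.266 / (47) p.267] -/
theorem continuumYM3Torus_of_effDensityRate {s w w' : ℕ → ℝ} (hs : Summable s) (hw : Summable w) (hw' : Summable w')
    (h : (F.unitFactorisation ℰ hE γ).EffDensityRate s w w') : ContinuumYM3Torus F ℰ γ :=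
  (continuumYM3Torus_iff_hasContinuumLimit_SU F ℰ hE hγ).mpr
    ((F.unitFactorisation ℰ hE γ).hasContinuumLimit_of_effDensityRate (F.scheme_β_nonneg ℰ hγ)
      (fun K C => F.measurable_avgObs (F.avgMeasurable_of_measurableE ℰ hE) K C) (fun K C U => F.abs_avgObs_le_one ℰ K C U)
      hs hw hw' h)

/-- **… IN LAW FORM**: under the same summable density-level comparison there is EXACTLY ONE OS-positive, `T₁`-covariant
continuum law of the unit-scale loop variables on the cube `[-1,1]^{ULoop3 F}` carrying all the limits (`T3ContinuumLaw`).
[cite: JaffeWittenClay2006, §6.5 p.11] -/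
theorem existsUnique_osLaw_of_effDensityRate {s w w' : ℕ → ℝ} (hs : Summable s) (hw : Summable w) (hw' : Summable w')
    (h : (F.unitFactorisation ℰ hE γ).EffDensityRate s w w') :
    ∃! ν, IsOSContinuumLaw3 F hE hγ ν :=
  (continuumYM3Torus_iff_existsUnique_osLaw F hE hγ).mp
    (continuumYM3Torus_of_effDensityRate F ℰ hE hγ hs hw hw' h)

/-- **R3 ON ONE THREE-TORUS ⇐ A SUMMABLE TRANSPORT RATE BETWEEN CONSECUTIVE UNIT LAWS**: couplings `κ_K` of `unitLaw K` and
`unitLaw (K+1)` moving every unit-lattice loop variable by at most `Δ_K` in mean, `Σ Δ_K < ∞` (tree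
`UnitFactorisation.hasContinuumLimit_of_effTransportRate`). [cite: JaffeWittenClay2006, §6.5 p.11] -/
theorem continuumYM3Torus_of_effTransportRate {Δ : ℕ → ℝ} (hΔ : Summable Δ)
    (h : (F.unitFactorisation ℰ hE γ).EffTransportRate Δ) : ContinuumYM3Torus F ℰ γ :=
  (continuumYM3Torus_iff_hasContinuumLimit_SU F ℰ hE hγ).mpr
    ((F.unitFactorisation ℰ hE γ).hasContinuumLimit_of_effTransportRate (F.scheme_β_nonneg ℰ hγ)
      (fun K C => F.measurable_avgObs (F.avgMeasurable_of_measurableE ℰ hE) K C) (fun K C U => F.abs_avgObs_le_one ℰ K C U)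
      hΔ h)

/-- **R3 ON ONE THREE-TORUS ⇐ A SUMMABLE `L²`-COST RATE BETWEEN CONSECUTIVE UNIT LAWS** (the second-moment currency; tree
`UnitFactorisation.hasContinuumLimit_of_effSecondMomentRate`). [cite: JaffeWittenClay2006, §6.5 p.11] -/
theorem continuumYM3Torus_of_effSecondMomentRate {Δ : ℕ → ℝ} (hΔ : Summable Δ)
    (h : (F.unitFactorisation ℰ hE γ).EffSecondMomentRate Δ) : ContinuumYM3Torus F ℰ γ :=
  (continuumYM3Torus_iff_hasContinuumLimit_SU F ℰ hE hγ).mpr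
    ((F.unitFactorisation ℰ hE γ).hasContinuumLimit_of_effSecondMomentRate (F.scheme_β_nonneg ℰ hγ)
      (fun K C => F.measurable_avgObs (F.avgMeasurable_of_measurableE ℰ hE) K C) hΔ h)

/-- **R3 ON ONE THREE-TORUS ⇐ A SUMMABLE COMMON-NOISE REALISATION RATE**: one probability space and measurable maps `Φ_K`,
`Ψ_K` realising `unitLaw K`, `unitLaw (K+1)` from the same randomness with
`‖W_C ∘ Ψ_K − W_C ∘ Φ_K‖_{L²} ≤ Δ_K`, `Σ Δ_K < ∞`
(tree `UnitFactorisation.hasContinuumLimit_of_commonNoiseRate`). [cite: JaffeWittenClay2006, §6.5 p.11] -/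
theorem continuumYM3Torus_of_commonNoiseRate {Ξ : Type*} [MeasurableSpace Ξ] {P : Measure Ξ}
    {Φ Ψ : ℕ → Ξ → GaugeField (F.P 0) 0 (Matrix.specialUnitaryGroup (Fin N) ℂ)} {Δ : ℕ → ℝ} (hΔ : Summable Δ)
    (h : (F.unitFactorisation ℰ hE γ).CommonNoiseRate P Φ Ψ Δ) : ContinuumYM3Torus F ℰ γ :=
  (continuumYM3Torus_iff_hasContinuumLimit_SU F ℰ hE hγ).mpr
    ((F.unitFactorisation ℰ hE γ).hasContinuumLimit_of_commonNoiseRate (F.scheme_β_nonneg ℰ hγ)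
      (fun K C => F.measurable_avgObs (F.avgMeasurable_of_measurableE ℰ hE) K C) hΔ h)

/-- **R3 ON ONE THREE-TORUS ⇐ A SUMMABLE TRANSPORT RATE AT THE FINEST COMMON LATTICE**: for every `K` a coupling `π_K` of the
Wilson measure `Gibbs_K` at spacing `ε_K` with `descLaw K` (ONE renormalization step of the Wilson measure at spacing `ε_K/L`, on
the same lattice) under which every `K`-fold-averaged loop variable `W_C ∘ A_K` moves by at most `Δ_K` in mean, `Σ Δ_K < ∞` —
the d = 3 expectations step stated on [Balaban1985UV3]'s own objects `(ρ₀ dU, Tρ₀ dV)` (tree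
`NestedFactorisation.hasContinuumLimit_of_fineTransportRate`). [cite: Balaban1985UV3, (1)-(3) p.256] -/
theorem continuumYM3Torus_of_fineTransportRate {Δ : ℕ → ℝ} (hΔ : Summable Δ)
    (h : (F.nestedFactorisation ℰ hE γ).FineTransportRate Δ) : ContinuumYM3Torus F ℰ γ :=
  (continuumYM3Torus_iff_hasContinuumLimit_SU F ℰ hE hγ).mpr
    ((F.nestedFactorisation ℰ hE γ).hasContinuumLimit_of_fineTransportRate (F.scheme_β_nonneg ℰ hγ)
      (fun K C => F.measurable_avgObs (F.avgMeasurable_of_measurableE ℰ hE) K C) hΔ h)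

/-- **R3 ON ONE THREE-TORUS ⇐ A SUMMABLE `L²`-COST RATE AT THE FINEST COMMON LATTICE** (a synchronous coupling of `Gibbs_K`
with `descLaw K`, cost read through the `K`-fold averaging; tree `NestedFactorisation.hasContinuumLimit_of_fineSecondMomentRate`).
[cite: Balaban1985UV3, (1)-(3) p.256] -/
theorem continuumYM3Torus_of_fineSecondMomentRate {Δ : ℕ → ℝ} (hΔ : Summable Δ)
    (h : (F.nestedFactorisation ℰ hE γ).FineSecondMomentRate Δ) : ContinuumYM3Torus F ℰ γ :=
  (continuumYM3Torus_iff_hasContinuumLimit_SU F ℰ hE hγ).mpr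
    ((F.nestedFactorisation ℰ hE γ).hasContinuumLimit_of_fineSecondMomentRate (F.scheme_β_nonneg ℰ hγ)
      (fun K C => F.measurable_avgObs (F.avgMeasurable_of_measurableE ℰ hE) K C) hΔ h)

end Apex

/-! ## §4 (v2) PRODUCER FORM in Bałaban's density currency: a two-run SANDWICH of Haar densities of the unit laws on good sets,
plus summable bad-set masses, IS a density-level rate — K1 ⊕ K2 on the unit lattice, typed over the scheme's own laws -/

section Densities

variable {G : Type*} {O : Type*} {S : TorusScheme G O} [MeasurableSpace G] [GaugeGroup G] [HaarData G] [RegularGaugeGroup G]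
  {X : Type*} [MeasurableSpace X] (U : T4VarianceMatching.UnitFactorisation S X)

/-- **THE DENSITY SANDWICH PRODUCES THE DENSITY-LEVEL RATE** (any `UnitFactorisation`, any reference measure `lam` — in Bałaban's
scheme `lam = dV`, product Haar on the unit lattice, and `ρ_K` = the effective density after `K` complete renormalization steps,
[Balaban1985UV3] (2)/(6)): if every effective unit-lattice law has a positive measurable density `ρ_K` w.r.t. `lam`, and on
measurable good sets `Gd_K` the densities of CONSECUTIVE runs satisfy the two-sided bound
`e^{−r_K} ρ_K ≤ ρ_{K+1} ≤ e^{r_K} ρ_K` (the K1 sandwich: the shape of [Balaban1985UV3] (41) p. 266 / (47) p. 267 read as a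
comparison of
the two runs' unit-scale densities, King's (3.9)–(3.10) p. 656), while the bad sets carry the single-run masses `μ_K(Gdᶜ) ≤ w_K`,
`μ_{K+1}(Gdᶜ) ≤ w'_K` (K2), then `EffDensityRate (e^{r_K} − 1) w w'` holds, with `g_K = ρ_{K+1}/ρ_K`.
[cite: Balaban1985UV3, (41) p.266 / (47) p.267] -/
theorem effDensityRate_of_densitySandwich (hβ : ∀ K, 0 ≤ S.β K) (lam : Measure X) (ρ : ℕ → X → ℝ)
    (hρm : ∀ K, Measurable (ρ K)) (hρpos : ∀ K x, 0 < ρ K x)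
    (hlaw : ∀ K, U.effLaw K = lam.withDensity (fun x => ENNReal.ofReal (ρ K x)))
    (Gd : ℕ → Set X) (hGd : ∀ K, MeasurableSet (Gd K)) {r w w' : ℕ → ℝ} (hr : ∀ K, 0 ≤ r K)
    (hsand : ∀ K, ∀ x ∈ Gd K, Real.exp (-r K) * ρ K x ≤ ρ (K + 1) x ∧ ρ (K + 1) x ≤ Real.exp (r K) * ρ K x)
    (hw : ∀ K, (U.effLaw K).real (Gd K)ᶜ ≤ w K) (hw' : ∀ K, (U.effLaw (K + 1)).real (Gd K)ᶜ ≤ w' K) :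
    U.EffDensityRate (fun K => Real.exp (r K) - 1) w w' := by
  intro K
  haveI : IsProbabilityMeasure (U.effLaw K) := U.isProbabilityMeasure_effLaw hβ K
  haveI : IsProbabilityMeasure (U.effLaw (K + 1)) := U.isProbabilityMeasure_effLaw hβ (K + 1)
  -- the density ratio
  set g : X → ℝ := fun x => ρ (K + 1) x / ρ K x with hg
  have hgm : Measurable g := (hρm (K + 1)).div (hρm K)
  have hg0 : ∀ x, 0 ≤ g x := fun x => div_nonneg (hρpos _ x).le (hρpos _ x).le
  -- the density equation `μ_{K+1} = g · μ_K`
  have hdens : U.effLaw (K + 1) = (U.effLaw K).withDensity (fun x => ENNReal.ofReal (g x)) := by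
    rw [hlaw (K + 1), hlaw K, ← withDensity_mul _ (hρm K).ennreal_ofReal hgm.ennreal_ofReal]
    congr 1
    funext x
    show ENNReal.ofReal (ρ (K + 1) x) = ENNReal.ofReal (ρ K x) * ENNReal.ofReal (g x)
    rw [← ENNReal.ofReal_mul (hρpos K x).le, hg]
    congr 1
    show ρ (K + 1) x = ρ K x * (ρ (K + 1) x / ρ K x)
    rw [mul_comm, div_mul_cancel₀ _ (hρpos K x).ne']
  -- `g` has total mass one, hence is integrable
  have hlin : ∫⁻ x, ENNReal.ofReal (g x) ∂U.effLaw K = 1 := by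
    have h := congrArg (fun m : Measure X => m Set.univ) hdens
    simp only [measure_univ, withDensity_apply _ MeasurableSet.univ, Measure.restrict_univ] at h
    exact h.symm
  have hgi : Integrable g (U.effLaw K) := by
    have h := integrable_toReal_of_lintegral_ne_top (μ := U.effLaw K) hgm.ennreal_ofReal.aemeasurable
      (by rw [hlin]; exact ENNReal.one_ne_top)
    exact h.congr (Eventually.of_forall fun x => ENNReal.toReal_ofReal (hg0 x))
  refine ⟨g, Gd K, hgm, hg0, hgi, hdens, hGd K, sub_nonneg.mpr (Real.one_le_exp (hr K)), fun x hx => ?_, hw K, ?_⟩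
  · -- the sandwich gives `e^{-r} ≤ g ≤ e^{r}`, hence `|g − 1| ≤ e^{r} − 1`
    have hlo : Real.exp (-r K) ≤ g x := by
      rw [hg, le_div_iff₀ (hρpos K x)]
      exact (hsand K x hx).1
    have hhi : g x ≤ Real.exp (r K) := by
      rw [hg, div_le_iff₀ (hρpos K x)]
      exact (hsand K x hx).2
    have hpos : 0 < Real.exp (r K) := Real.exp_pos _
    have hprod : Real.exp (-r K) * Real.exp (r K) = 1 := by rw [Real.exp_neg, inv_mul_cancel₀ hpos.ne']
    rw [abs_le]
    constructor
    · nlinarith [sq_nonneg (Real.exp (r K) - 1), hlo, hprod, hpos]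
    · linarith
  · -- `∫_{Gdᶜ} g dμ_K = μ_{K+1}(Gdᶜ) ≤ w'_K`
    have h1 : ∫ x in (Gd K)ᶜ, g x ∂U.effLaw K = ((U.effLaw (K + 1)) (Gd K)ᶜ).toReal := by
      rw [integral_eq_lintegral_of_nonneg_ae (Eventually.of_forall hg0) hgm.aestronglyMeasurable, hdens,
        withDensity_apply _ (hGd K).compl]
    rw [h1]
    exact hw' K

end Densities

section DensitiesT3

variable {N : ℕ} [NeZero N] (F : T3Family) (ℰ : LoopAverage (Matrix.specialUnitaryGroup (Fin N) ℂ))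
  (hE : ℰ.MeasurableE) {γ : ℝ} (hγ : 0 ≤ γ)

include hγ

/-- **R3 ON ONE THREE-TORUS ⇐ THE K1 SANDWICH ⊕ K2 MASSES ON THE UNIT LATTICE, in [Balaban1985UV3]'s density currency** (`SU(N)`,
measurable `ℰ`, `γ ≥ 0`): positive measurable densities `ρ_K` of the unit laws w.r.t. a reference measure (product Haar on
`T₁`), good sets with the two-run sandwich `e^{−r_K}ρ_K ≤ ρ_{K+1} ≤ e^{r_K}ρ_K`, bad-set masses `w_K`, `w'_K`, and
`Σ (e^{r_K} − 1), Σ w_K, Σ w'_K < ∞` give `ContinuumYM3Torus F ℰ γ` — all four conjuncts.  This is the statement the d = 3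
expectations step must supply; its radii `r_K` compare the TWO RUNS' unit-scale densities with each other (King's device), not each
with the (41)/(47) envelope. [cite: Balaban1985UV3, (41) p.266 / (47) p.267] -/
theorem continuumYM3Torus_of_densitySandwich (lam : Measure (GaugeField (F.P 0) 0 (Matrix.specialUnitaryGroup (Fin N) ℂ)))
    (ρ : ℕ → GaugeField (F.P 0) 0 (Matrix.specialUnitaryGroup (Fin N) ℂ) → ℝ)
    (hρm : ∀ K, Measurable (ρ K)) (hρpos : ∀ K x, 0 < ρ K x)
    (hlaw : ∀ K, F.unitLaw ℰ hE γ K = lam.withDensity (fun x => ENNReal.ofReal (ρ K x)))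
    (Gd : ℕ → Set (GaugeField (F.P 0) 0 (Matrix.specialUnitaryGroup (Fin N) ℂ))) (hGd : ∀ K, MeasurableSet (Gd K))
    {r w w' : ℕ → ℝ} (hr : ∀ K, 0 ≤ r K)
    (hsand : ∀ K, ∀ x ∈ Gd K, Real.exp (-r K) * ρ K x ≤ ρ (K + 1) x ∧ ρ (K + 1) x ≤ Real.exp (r K) * ρ K x)
    (hw : ∀ K, (F.unitLaw ℰ hE γ K).real (Gd K)ᶜ ≤ w K) (hw' : ∀ K, (F.unitLaw ℰ hE γ (K + 1)).real (Gd K)ᶜ ≤ w' K)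
    (hs : Summable fun K => Real.exp (r K) - 1) (hws : Summable w) (hws' : Summable w') : ContinuumYM3Torus F ℰ γ :=
  continuumYM3Torus_of_effDensityRate F ℰ hE hγ hs hws hws'
    (effDensityRate_of_densitySandwich (F.unitFactorisation ℰ hE γ) (F.scheme_β_nonneg ℰ hγ) lam ρ hρm hρpos hlaw Gd hGd hr
      hsand hw hw')

end DensitiesT3

/-! ## §5 (v3) PRODUCER FORM MODULO CONSTANTS: the sandwich may carry an unknown `K`-dependent constant — normalisation
removes it (no matching of partition functions / vacuum-energy constants `E_k` is needed for (E3) in this currency) -/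

section ModConst

variable {G : Type*} {O : Type*} {S : TorusScheme G O} [MeasurableSpace G] [GaugeGroup G] [HaarData G] [RegularGaugeGroup G]
  {X : Type*} [MeasurableSpace X] (U : T4VarianceMatching.UnitFactorisation S X)

/-- **THE SANDWICH MODULO CONSTANTS PRODUCES THE DENSITY-LEVEL RATE**: if on the good sets
`e^{−r_K} c_K ρ_K ≤ ρ_{K+1} ≤ e^{r_K} c_K ρ_K` with an ARBITRARY constant `c_K > 0` (absorbing the two runs' vacuum-energy
constants `E_k` of [Balaban1985UV3] (1)/(41) and the ratio of partition functions (6)), and the bad sets have single-run masses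
`≤ w_K ≤ 1/2`, `≤ w'_K`, then normalisation pins `c_K` (`(1 − w'_K)e^{−r_K} ≤ c_K ≤ e^{r_K}/(1 − w_K)`) and
`EffDensityRate s w w'` holds with `s_K = (e^{r_K})²/(1 − w_K) − 1 + w'_K` (summable as soon as `r`, `w`, `w'` are).
[cite: Balaban1985UV3, (6) p.257 + (41) p.266 / (47) p.267] -/
theorem effDensityRate_of_densitySandwichModConst (hβ : ∀ K, 0 ≤ S.β K) (lam : Measure X) (ρ : ℕ → X → ℝ)
    (hρm : ∀ K, Measurable (ρ K)) (hρpos : ∀ K x, 0 < ρ K x)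
    (hlaw : ∀ K, U.effLaw K = lam.withDensity (fun x => ENNReal.ofReal (ρ K x)))
    (Gd : ℕ → Set X) (hGd : ∀ K, MeasurableSet (Gd K)) {r w w' : ℕ → ℝ} (c : ℕ → ℝ) (hr : ∀ K, 0 ≤ r K)
    (hc : ∀ K, 0 < c K) (hw1 : ∀ K, w K ≤ 1 / 2)
    (hsand : ∀ K, ∀ x ∈ Gd K,
      Real.exp (-r K) * c K * ρ K x ≤ ρ (K + 1) x ∧ ρ (K + 1) x ≤ Real.exp (r K) * c K * ρ K x)
    (hw : ∀ K, (U.effLaw K).real (Gd K)ᶜ ≤ w K) (hw' : ∀ K, (U.effLaw (K + 1)).real (Gd K)ᶜ ≤ w' K) :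
    U.EffDensityRate (fun K => Real.exp (r K) ^ 2 / (1 - w K) - 1 + w' K) w w' := by
  intro K
  haveI : IsProbabilityMeasure (U.effLaw K) := U.isProbabilityMeasure_effLaw hβ K
  haveI : IsProbabilityMeasure (U.effLaw (K + 1)) := U.isProbabilityMeasure_effLaw hβ (K + 1)
  -- the density ratio and the density equation (as in §4)
  set g : X → ℝ := fun x => ρ (K + 1) x / ρ K x with hg
  have hgm : Measurable g := (hρm (K + 1)).div (hρm K)
  have hg0 : ∀ x, 0 ≤ g x := fun x => div_nonneg (hρpos _ x).le (hρpos _ x).le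
  have hdens : U.effLaw (K + 1) = (U.effLaw K).withDensity (fun x => ENNReal.ofReal (g x)) := by
    rw [hlaw (K + 1), hlaw K, ← withDensity_mul _ (hρm K).ennreal_ofReal hgm.ennreal_ofReal]
    congr 1
    funext x
    show ENNReal.ofReal (ρ (K + 1) x) = ENNReal.ofReal (ρ K x) * ENNReal.ofReal (g x)
    rw [← ENNReal.ofReal_mul (hρpos K x).le, hg]
    congr 1
    show ρ (K + 1) x = ρ K x * (ρ (K + 1) x / ρ K x)
    rw [mul_comm, div_mul_cancel₀ _ (hρpos K x).ne']
  have hlin : ∫⁻ x, ENNReal.ofReal (g x) ∂U.effLaw K = 1 := by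
    have h := congrArg (fun m : Measure X => m Set.univ) hdens
    simp only [measure_univ, withDensity_apply _ MeasurableSet.univ, Measure.restrict_univ] at h
    exact h.symm
  have hgi : Integrable g (U.effLaw K) := by
    have h := integrable_toReal_of_lintegral_ne_top (μ := U.effLaw K) hgm.ennreal_ofReal.aemeasurable
      (by rw [hlin]; exact ENNReal.one_ne_top)
    exact h.congr (Eventually.of_forall fun x => ENNReal.toReal_ofReal (hg0 x))
  -- set integrals of `g` are `μ_{K+1}`-masses
  have hset : ∀ {A : Set X}, MeasurableSet A → ∫ x in A, g x ∂U.effLaw K = (U.effLaw (K + 1)).real A := by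
    intro A hA
    rw [integral_eq_lintegral_of_nonneg_ae (Eventually.of_forall hg0) hgm.aestronglyMeasurable, hdens,
      measureReal_def, withDensity_apply _ hA]
  -- elementary bounds
  have hE : 0 < Real.exp (r K) := Real.exp_pos _
  have hE1 : 1 ≤ Real.exp (r K) := Real.one_le_exp (hr K)
  have hEneg : Real.exp (-r K) = (Real.exp (r K))⁻¹ := Real.exp_neg _
  have hw0 : 0 ≤ w K := le_trans measureReal_nonneg (hw K)
  have hw0' : 0 ≤ w' K := le_trans measureReal_nonneg (hw' K)
  have h1w : 0 < 1 - w K := by linarith [hw1 K]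
  have hGd_mass : 1 - w K ≤ (U.effLaw K).real (Gd K) := by
    have := probReal_compl_eq_one_sub (μ := U.effLaw K) (hGd K)
    linarith [hw K]
  have hGd_mass' : 1 - w' K ≤ (U.effLaw (K + 1)).real (Gd K) := by
    have := probReal_compl_eq_one_sub (μ := U.effLaw (K + 1)) (hGd K)
    linarith [hw' K]
  have hm1 : (U.effLaw (K + 1)).real (Gd K) ≤ 1 := measureReal_le_one
  have hm1' : (U.effLaw K).real (Gd K) ≤ 1 := measureReal_le_one
  -- on the good set: `c/e^{r} ≤ g ≤ c e^{r}`
  have hglo : ∀ x ∈ Gd K, c K / Real.exp (r K) ≤ g x := fun x hx => by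
    rw [hg, le_div_iff₀ (hρpos K x)]
    have h := (hsand K x hx).1
    rw [hEneg] at h
    calc c K / Real.exp (r K) * ρ K x = (Real.exp (r K))⁻¹ * c K * ρ K x := by ring
      _ ≤ ρ (K + 1) x := h
  have hghi : ∀ x ∈ Gd K, g x ≤ c K * Real.exp (r K) := fun x hx => by
    rw [hg, div_le_iff₀ (hρpos K x)]
    calc ρ (K + 1) x ≤ Real.exp (r K) * c K * ρ K x := (hsand K x hx).2
      _ = c K * Real.exp (r K) * ρ K x := by ring
  -- normalisation pins the constant
  have hup : (U.effLaw (K + 1)).real (Gd K) ≤ c K * Real.exp (r K) * (U.effLaw K).real (Gd K) := by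
    have h := setIntegral_mono_on hgi.integrableOn (integrable_const (c K * Real.exp (r K))).integrableOn (hGd K) hghi
    rwa [setIntegral_const, smul_eq_mul, mul_comm, hset (hGd K)] at h
  have hdown : c K / Real.exp (r K) * (U.effLaw K).real (Gd K) ≤ (U.effLaw (K + 1)).real (Gd K) := by
    have h := setIntegral_mono_on (integrable_const (c K / Real.exp (r K))).integrableOn hgi.integrableOn (hGd K) hglo
    rwa [setIntegral_const, smul_eq_mul, mul_comm, hset (hGd K)] at h
  have hcu : c K * (1 - w K) ≤ Real.exp (r K) := by
    have h1 : c K / Real.exp (r K) * (1 - w K) ≤ c K / Real.exp (r K) * (U.effLaw K).real (Gd K) :=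
      mul_le_mul_of_nonneg_left hGd_mass (div_nonneg (hc K).le hE.le)
    have h2 : c K / Real.exp (r K) * (1 - w K) ≤ 1 := h1.trans (hdown.trans hm1)
    rwa [div_mul_eq_mul_div, div_le_iff₀ hE, one_mul] at h2
  have hcd : 1 - w' K ≤ c K * Real.exp (r K) := by
    have h1 : c K * Real.exp (r K) * (U.effLaw K).real (Gd K) ≤ c K * Real.exp (r K) * 1 :=
      mul_le_mul_of_nonneg_left hm1' (mul_nonneg (hc K).le hE.le)
    linarith [hGd_mass', hup]
  -- two-sided bounds on `g` on the good set, free of `c`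
  have hx_hi : ∀ x ∈ Gd K, g x ≤ Real.exp (r K) ^ 2 / (1 - w K) := fun x hx => by
    have h : c K ≤ Real.exp (r K) / (1 - w K) := by rw [le_div_iff₀ h1w]; exact hcu
    calc g x ≤ c K * Real.exp (r K) := hghi x hx
      _ ≤ Real.exp (r K) / (1 - w K) * Real.exp (r K) := mul_le_mul_of_nonneg_right h hE.le
      _ = Real.exp (r K) ^ 2 / (1 - w K) := by ring
  have hx_lo : ∀ x ∈ Gd K, (1 - w' K) / Real.exp (r K) ^ 2 ≤ g x := fun x hx => by
    have h : (1 - w' K) / Real.exp (r K) ≤ c K := by rw [div_le_iff₀ hE]; exact hcd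
    calc (1 - w' K) / Real.exp (r K) ^ 2 = ((1 - w' K) / Real.exp (r K)) / Real.exp (r K) := by ring
      _ ≤ c K / Real.exp (r K) := div_le_div_of_nonneg_right h hE.le
      _ ≤ g x := hglo x hx
  have hE2pos : 0 < Real.exp (r K) ^ 2 := by positivity
  have hE2 : 1 ≤ Real.exp (r K) ^ 2 := by nlinarith [hE1]
  have hdiv : Real.exp (r K) ^ 2 ≤ Real.exp (r K) ^ 2 / (1 - w K) := by
    rw [le_div_iff₀ h1w]
    nlinarith [hw0, hE2pos]
  refine ⟨g, Gd K, hgm, hg0, hgi, hdens, hGd K, ?_, fun x hx => ?_, hw K, ?_⟩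
  · -- `0 ≤ s_K`
    linarith [hdiv, hE2, hw0']
  · -- `|g − 1| ≤ s_K` on the good set
    rw [abs_le]
    constructor
    · have hkey : 2 - Real.exp (r K) ^ 2 - w' K ≤ (1 - w' K) / Real.exp (r K) ^ 2 := by
        rw [le_div_iff₀ hE2pos]
        nlinarith [sq_nonneg (Real.exp (r K) ^ 2 - 1), hw0', hE2]
      linarith [hkey, hx_lo x hx, hdiv]
    · linarith [hx_hi x hx, hw0']
  · -- `∫_{Gdᶜ} g dμ_K = μ_{K+1}(Gdᶜ) ≤ w'_K`
    rw [hset (hGd K).compl]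
    exact hw' K

end ModConst

section ModConstT3

variable {N : ℕ} [NeZero N] (F : T3Family) (ℰ : LoopAverage (Matrix.specialUnitaryGroup (Fin N) ℂ))
  (hE : ℰ.MeasurableE) {γ : ℝ} (hγ : 0 ≤ γ)

include hγ

/-- **R3 ON ONE THREE-TORUS ⇐ THE TWO-RUN DENSITY SANDWICH MODULO CONSTANTS ⊕ BAD-SET MASSES** (`SU(N)`, measurable `ℰ`,
`γ ≥ 0`; the d = 3 statement the expectations step must supply, in [Balaban1985UV3]'s density currency with the vacuum-energy /
partition-function constants left FREE): positive measurable densities `ρ_K` of the unit laws w.r.t. a reference measure,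
measurable good sets `Gd_K`, constants `c_K > 0`, radii `r_K ≥ 0` with `e^{−r_K}c_Kρ_K ≤ ρ_{K+1} ≤ e^{r_K}c_Kρ_K` on `Gd_K`,
bad-set masses `μ_K(Gd_Kᶜ) ≤ w_K ≤ 1/2`, `μ_{K+1}(Gd_Kᶜ) ≤ w'_K`, and `Σ ((e^{r_K})²/(1−w_K) − 1 + w'_K), Σ w_K, Σ w'_K < ∞`
give `ContinuumYM3Torus F ℰ γ`. [cite: Balaban1985UV3, (6) p.257 + (41) p.266 / (47) p.267] -/
theorem continuumYM3Torus_of_densitySandwichModConst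
    (lam : Measure (GaugeField (F.P 0) 0 (Matrix.specialUnitaryGroup (Fin N) ℂ)))
    (ρ : ℕ → GaugeField (F.P 0) 0 (Matrix.specialUnitaryGroup (Fin N) ℂ) → ℝ)
    (hρm : ∀ K, Measurable (ρ K)) (hρpos : ∀ K x, 0 < ρ K x)
    (hlaw : ∀ K, F.unitLaw ℰ hE γ K = lam.withDensity (fun x => ENNReal.ofReal (ρ K x)))
    (Gd : ℕ → Set (GaugeField (F.P 0) 0 (Matrix.specialUnitaryGroup (Fin N) ℂ))) (hGd : ∀ K, MeasurableSet (Gd K))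
    {r w w' : ℕ → ℝ} (c : ℕ → ℝ) (hr : ∀ K, 0 ≤ r K) (hc : ∀ K, 0 < c K) (hw1 : ∀ K, w K ≤ 1 / 2)
    (hsand : ∀ K, ∀ x ∈ Gd K,
      Real.exp (-r K) * c K * ρ K x ≤ ρ (K + 1) x ∧ ρ (K + 1) x ≤ Real.exp (r K) * c K * ρ K x)
    (hw : ∀ K, (F.unitLaw ℰ hE γ K).real (Gd K)ᶜ ≤ w K) (hw' : ∀ K, (F.unitLaw ℰ hE γ (K + 1)).real (Gd K)ᶜ ≤ w' K)
    (hs : Summable fun K => Real.exp (r K) ^ 2 / (1 - w K) - 1 + w' K) (hws : Summable w) (hws' : Summable w') :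
    ContinuumYM3Torus F ℰ γ :=
  continuumYM3Torus_of_effDensityRate F ℰ hE hγ hs hws hws'
    (effDensityRate_of_densitySandwichModConst (F.unitFactorisation ℰ hE γ) (F.scheme_β_nonneg ℰ hγ) lam ρ hρm hρpos hlaw Gd
      hGd c hr hc hw1 hsand hw hw')

end ModConstT3

end Literature.MathematicalPhysics.QuantumFieldTheory.Balaban1983to89.T3NestedUnitLaws

end
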